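import Mathlib
import Summits.Ventures.HodgeRepro.Tier3LagrangianGraph

/-!
# Tier3DoublingUnfold — the algebraic skeleton of the unfolding of the doubling zeta integral
(T3.5 for T3.1; PERIOD-ADDENDUM-9 §A9.3 step 2)

Step 2 of §A9.3 unfolds the Piatetski-Shapiro–Rallis zeta integral `Z(s, f₁, f₂, Φ_s, γ_W)` for `Re s > 1`:
the Siegel Eisenstein series is a sum over `P(E′⁺) \ U(W ⊕ W⁻)(E′⁺)`, which is ONE orbit of `U(W) × U(W)`
(Tier3LagrangianGraph) with stabiliser the DIAGONAL `U(W)^Δ`, so the sum runs over `h ∈ U(W)(E′⁺)` via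
`h ↦ P · ι(h, 1)`; the left `P`-equivariance of `Φ_s` moves the diagonal `ι(g₂, g₂)` into `P`, producing the
character `γ_W(det g₂)` that Definition 5.7's factor `γ_W⁻¹(det g₂)` cancels; and the substitution `g₁ = g₂ g`
turns the double integral into `⟨T_s f₁, f₂⟩` with `T_s = ∫ Φ_s(ι(g, 1)) R(g) dg`.  This file is the algebra of
those three moves, with finite sums standing for the integrals:
* the stabiliser of the diagonal Lagrangian `graph id` in `GL(V) × GL(V)` is the diagonal
  (`map_prodMap_graph_id_eq_iff`, from Tier3LagrangianGraph's `map_prodMap_graph`);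
* the factorisation `ι(h g₁, g₂) = ι(g₂, g₂) · ι(g₂⁻¹ h g₁, 1)` and the equivariance bookkeeping
  `Φ(ι(h g₁, g₂)) = γ(g₂) · Φ(ι(g₂⁻¹ h g₁, 1))`, cancelled by `γ(g₂)⁻¹` (`apply_prod_eq_mul`,
  `inv_mul_apply_prod`);
* the re-indexing `Σ_{g₁, g₂} f₁(g₁) f₂(g₂) Ψ(g₂⁻¹ g₁) = Σ_{g₂} f₂(g₂) Σ_g Ψ(g) f₁(g₂ g)` (`sum_sum_eq_sum_translate`)
  and the unfolding of a sum over a subgroup of left-invariance (`sum_sum_left_invariant`).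
What stays on the page: the absolute convergence of the Eisenstein series for `Re s > ρ` and the interchange
of the rational sum with the integral over the compact `[U(W)]²` (PRINTED / CELL analysis, §A9.3 step 2).
No definition, no notation; imports Mathlib and Tier3LagrangianGraph.
Nothing here asserts anything about the original programme; HC_CM is NOT proved by anyone in this repository.
-/

namespace HodgeRepro.T3P1.DoublingUnfold

open Finset

section Stabiliser

variable {K V : Type*} [Field K] [AddCommGroup V] [Module K V]

/-- The graph of a linear map determines the map. -/
theorem graph_eq_graph_iff {α β : V →ₗ[K] V} :
    LinearMap.graph α = LinearMap.graph β ↔ α = β := by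
  constructor
  · intro h
    ext v
    have hv : (v, α v) ∈ LinearMap.graph β := by
      rw [← h, LinearMap.mem_graph_iff]
    rw [LinearMap.mem_graph_iff] at hv
    exact hv
  · rintro rfl
    rfl

/-- **The stabiliser of the diagonal Lagrangian is the diagonal.** `(g₁, g₂)` carries `Δ = graph id` to
itself iff `g₁ = g₂`: `P ∩ ι(U(W) × U(W)) = ι(U(W)^Δ)`, so `P \ U(W ⊕ W⁻) ≅ (U(W) × U(W)) / U(W)^Δ ≅ U(W)`
via `h ↦ P · ι(h, 1)` — the indexing of the unfolded sum in §A9.3 step 2. -/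
theorem map_prodMap_graph_id_eq_iff (g₁ g₂ : V ≃ₗ[K] V) :
    Submodule.map (LinearMap.prodMap (g₁ : V →ₗ[K] V) (g₂ : V →ₗ[K] V))
        (LinearMap.graph (LinearMap.id : V →ₗ[K] V))
      = LinearMap.graph (LinearMap.id : V →ₗ[K] V) ↔ g₁ = g₂ := by
  rw [HodgeRepro.T3P1.LagrangianGraph.map_prodMap_graph, graph_eq_graph_iff]
  constructor
  · intro h
    ext v
    have hv := LinearMap.congr_fun h (g₁ v)
    simpa using hv.symm
  · rintro rfl
    ext v
    simp

end Stabiliser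

section Equivariance

variable {G H : Type*} [Group G] [Group H]

/-- The diagonal factorisation `ι(h g₁, g₂) = ι(g₂, g₂) · ι(g₂⁻¹ h g₁, 1)` for a homomorphism
`ι : H × H →* G` (the route's `ι : U(W) × U(W) → U(W ⊕ W⁻)`). -/
theorem map_mul_prod_eq (ι : H × H →* G) (h g₁ g₂ : H) :
    ι (h * g₁, g₂) = ι (g₂, g₂) * ι (g₂⁻¹ * h * g₁, 1) := by
  rw [← map_mul]
  congr 1
  ext
  · simp [mul_assoc]
  · simp

/-- **The `P`-equivariance bookkeeping of §A9.3 step 2.** If `Φ` is left-equivariant under the diagonal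
(`Φ (ι (g, g) * x) = χ (ι (g, g)) * Φ x`, the diagonal lying in `P`) with `χ (ι (g, g)) = γ g` (the
character `γ_W(det g)` of the Siegel parabolic restricted to the diagonal), then
`Φ (ι (h g₁, g₂)) = γ g₂ * Φ (ι (g₂⁻¹ h g₁, 1))`. -/
theorem apply_prod_eq_mul (ι : H × H →* G) (Φ : G → ℂ) (χ : G → ℂ) (γ : H → ℂ)
    (hΦ : ∀ g x, Φ (ι (g, g) * x) = χ (ι (g, g)) * Φ x) (hχ : ∀ g, χ (ι (g, g)) = γ g)
    (h g₁ g₂ : H) : Φ (ι (h * g₁, g₂)) = γ g₂ * Φ (ι (g₂⁻¹ * h * g₁, 1)) := by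
  rw [map_mul_prod_eq, hΦ, hχ]

/-- The cancellation with Definition 5.7's factor `γ⁻¹(g₂)`: `(γ g₂)⁻¹ * Φ (ι (h g₁, g₂)) = Φ (ι (g₂⁻¹ h g₁, 1))`
when `γ g₂ ≠ 0` (a character value). -/
theorem inv_mul_apply_prod (ι : H × H →* G) (Φ : G → ℂ) (χ : G → ℂ) (γ : H → ℂ)
    (hΦ : ∀ g x, Φ (ι (g, g) * x) = χ (ι (g, g)) * Φ x) (hχ : ∀ g, χ (ι (g, g)) = γ g)
    (h g₁ g₂ : H) (hγ : γ g₂ ≠ 0) :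
    (γ g₂)⁻¹ * Φ (ι (h * g₁, g₂)) = Φ (ι (g₂⁻¹ * h * g₁, 1)) := by
  rw [apply_prod_eq_mul ι Φ χ γ hΦ hχ, inv_mul_cancel_left₀ hγ]

end Equivariance

section FiniteModel

variable {H : Type*} [Group H] [Fintype H]

/-- **The unfolding as a re-indexing (finite model of `Z(s, f₁, f₂) = ⟨T_s f₁, f₂⟩`).** For a finite group
`H`, `Σ_{g₁, g₂} f₁ g₁ * f₂ g₂ * Ψ (g₂⁻¹ g₁) = Σ_{g₂} f₂ g₂ * Σ_g Ψ g * f₁ (g₂ g)` — the substitution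
`g₁ = g₂ g`; the inner sum is `(T f₁)(g₂)` for `T = Σ_g Ψ g · R(g)`, `R` the right regular action. On the
adelic groups the same substitution runs inside the integral over `[U(W)]²` (absolute convergence for
`Re s > 1`, on the page). -/
theorem sum_sum_eq_sum_translate (f₁ f₂ Ψ : H → ℂ) :
    ∑ g₁, ∑ g₂, f₁ g₁ * f₂ g₂ * Ψ (g₂⁻¹ * g₁) = ∑ g₂, f₂ g₂ * ∑ g, Ψ g * f₁ (g₂ * g) := by
  rw [Finset.sum_comm]
  refine Finset.sum_congr rfl fun g₂ _ => ?_
  rw [Finset.mul_sum]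
  exact (Finset.sum_equiv (Equiv.mulLeft g₂) (by simp)
    (fun g _ => by simp only [Equiv.coe_mulLeft, inv_mul_cancel_left]; ring)).symm

/-- **Unfolding a sum over a subgroup of left-invariance (finite model of `Σ_{h ∈ H(F)} ∫_{[H]} = ∫_{H(𝔸)}`).**
If `f₁` is left-invariant under a subgroup `H'` (`f₁ (h * g) = f₁ g` for `h ∈ H'`), then
`Σ_{h ∈ H'} Σ_{g} f₁ g * F (h * g) = |H'| * Σ_g f₁ g * F g` — the factor `|H'|` is the finite model's «volume». -/
theorem sum_sum_left_invariant (H' : Subgroup H) [DecidablePred (· ∈ H')] (f₁ F : H → ℂ)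
    (hf₁ : ∀ h ∈ H', ∀ g, f₁ (h * g) = f₁ g) :
    ∑ h ∈ (Finset.univ.filter (· ∈ H')), ∑ g, f₁ g * F (h * g)
      = (Finset.univ.filter (· ∈ H')).card * ∑ g, f₁ g * F g := by
  have hinner : ∀ h ∈ (Finset.univ.filter (· ∈ H')), ∑ g, f₁ g * F (h * g) = ∑ g, f₁ g * F g := by
    intro h hh
    have hh' : h ∈ H' := (Finset.mem_filter.mp hh).2
    exact Finset.sum_equiv (Equiv.mulLeft h) (by simp)
      (fun g _ => by simp only [Equiv.coe_mulLeft, hf₁ h hh'])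
  rw [Finset.sum_congr rfl hinner, Finset.sum_const, nsmul_eq_mul]

end FiniteModel

end HodgeRepro.T3P1.DoublingUnfold
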